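import Literature.Algebra.EuclideanLattices.ARVerifierMachineBricks
import Literature.Algebra.EuclideanLattices.FarCertMachine
import Literature.Computability.Complexity.RatBricks
import HarnessLib

/-!
# The integer verifier of the machine-level MR07 Thm. 5.23 as an `FP` string function

Topic `Algebra/EuclideanLattices` (family `pqc`). Machine-level piece of the rendering of Micciancio–Regev
2007, Thm. 5.23 (`Literature.Computability.Cryptography.MicciancioRegev2007_gapCVP'_to_SIS'`): the reduction
ends by running a verifier on `N` witnesses `wⱼ = uⱼ/D ∈ L(B)*` (authors' version p. 28, the verifier `V`).
Its machine form decides the all-integer predicate `MicciancioRegev2007.VerifierZ.intAcceptsZ t a b D P u` of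
`MRGapCVPVerifierZInt.lean` — with `eⱼ = ⟨t, uⱼ⟩`, `εⱼ = eⱼ − round(eⱼ/D)·D`, `G = [u₁ ⋯ u_N]`, `k = 2^P`:

  (b′) `3 N D² ≤ 80 ∑ⱼ εⱼ²`  and  (c′) `(100 a²)^k tr((G Gᵀ)^k) ≤ (3 N D² b²)^k`.

This file writes that computation as ONE total string function `verdictF` on CANONICAL records

  `z = ⟨yd, ⟨bin n, ⟨rowCode t, ⟨dpEnc D, ⟨bin D, ⟨dpEnc a, ⟨dpEnc b, ⟨bin N, ⟨bin P, matCode u⟩⟩⟩⟩⟩⟩⟩⟩⟩`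

(the yardstick `yd` and all codes are supplied by the calling reduction, so no parsing is needed), all
registers saturated at the width `W = |yd|` (`capZ`, so that the maps and loops compose in `FP`, exactly as
in the tree's `ARVerifierMachine.lean`, whose bricks are reused: `dotF`, `qroundF`, `transposeF`, `gramRF`,
`sqLoopF`, `AdjMachine.traceF`, `powLoopF`):

* Part A — the machine: per-sample residuals `epsF` (a `mapLF`), `SF = ∑ εⱼ²`, test (b′) `testBF`; the
  transposed table `UF`, the Gram matrix `MF`, `P − 1` squarings `MpF`, the trace `trF = tr((GGᵀ)^{2^P})`,
  the powers `alphaPF = (100a²)^{2^P}`, `betaPF = (3ND²b²)^{2^P}`, test (c′) `testCF`, and `verdictF`;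
* Part B — `verdictF ∈ FP` (closure of `FP` under composition, pairing, bounded maps and loops);
* Part C — the saturated arithmetic `Spec.*` the stages compute and the STAGEWISE VALUES on a canonical
  record (`verdictF_rec`), under the side conditions `n, N, P ≤ W`, `1 ≤ P`, `0 < D`.

That the saturations are inactive for a wide enough yardstick (so that `Spec.verdict = intAcceptsZ`) is
arithmetic on magnitudes, kept for the sequel together with the choice of the yardstick by the reduction.
Everything is proved; no named facts.

## References

* D. Micciancio, O. Regev, *Worst-case to average-case reductions based on Gaussian measures*,
  SIAM J. Comput. 37 (2007) 267–302; authors' version, Thm. 5.23 (the verifier `V`, p. 28).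
* D. Aharonov, O. Regev, *Lattice problems in NP ∩ coNP*, J. ACM 52 (2005) 749–765, §6 (the integer form
  of the tests follows the tree's `ARVerifier.lean`).
* S. Arora, B. Barak, *Computational Complexity: A Modern Approach*, CUP 2009, §1.3 (closure properties of
  polynomial time). [AroraBarak2009]
-/

noncomputable section

namespace Literature.Algebra.EuclideanLattices

open _root_.Computability Literature.Computability.Complexity Literature.Computability.Complexity.Brick Polynomial
open LLLMachine PRelSigPi FarCertMachine ARMachine
open scoped Matrix

namespace MRVerifierMachine

/-! ## Part A. The machine -/

/-! ### Getters of the record `z = ⟨yd, ⟨nn, ⟨tn, ⟨dD, ⟨dN, ⟨aa, ⟨bb, ⟨NN, ⟨PP, UL⟩⟩⟩⟩⟩⟩⟩⟩⟩` -/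

/-- The yardstick `yd`. [folklore] -/
def gYd : List Bool → List Bool := nthF 0
/-- `bin n`. [folklore] -/
def gNn : List Bool → List Bool := nthF 1
/-- `rowCode t`. [folklore] -/
def gTn : List Bool → List Bool := nthF 2
/-- `dpEnc D`. [folklore] -/
def gDD : List Bool → List Bool := nthF 3
/-- `bin D`. [folklore] -/
def gDN : List Bool → List Bool := nthF 4
/-- `dpEnc a` (the numerator of `d`). [folklore] -/
def gAa : List Bool → List Bool := nthF 5
/-- `dpEnc b` (the denominator of `d`). [folklore] -/
def gBb : List Bool → List Bool := nthF 6
/-- `bin N`. [folklore] -/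
def gNN : List Bool → List Bool := nthF 7
/-- `bin P`. [folklore] -/
def gPP : List Bool → List Bool := nthF 8
/-- `matCode u` (the `N` witness numerators, `N × n`). [folklore] -/
def gUL : List Bool → List Bool := sndPow 8

/-- The canonical input record. [folklore] -/
def recOf (yd nn tn dD dN aa bb NN PP UL : List Bool) : List Bool :=
  boolPair yd (boolPair nn (boolPair tn (boolPair dD (boolPair dN (boolPair aa (boolPair bb (boolPair NN (boolPair PP UL))))))))

section Getters

variable (yd nn tn dD dN aa bb NN PP UL : List Bool)

/-- The getters on a record. [folklore] -/
theorem getters_apply :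
    gYd (recOf yd nn tn dD dN aa bb NN PP UL) = yd ∧ gNn (recOf yd nn tn dD dN aa bb NN PP UL) = nn ∧
    gTn (recOf yd nn tn dD dN aa bb NN PP UL) = tn ∧ gDD (recOf yd nn tn dD dN aa bb NN PP UL) = dD ∧
    gDN (recOf yd nn tn dD dN aa bb NN PP UL) = dN ∧ gAa (recOf yd nn tn dD dN aa bb NN PP UL) = aa ∧
    gBb (recOf yd nn tn dD dN aa bb NN PP UL) = bb ∧ gNN (recOf yd nn tn dD dN aa bb NN PP UL) = NN ∧
    gPP (recOf yd nn tn dD dN aa bb NN PP UL) = PP ∧ gUL (recOf yd nn tn dD dN aa bb NN PP UL) = UL := by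
  simp [gYd, gNn, gTn, gDD, gDN, gAa, gBb, gNN, gPP, gUL, recOf]

end Getters

/-! ### The per-sample residual `εⱼ`, on the item record `r = ⟨yd, ⟨⟨nn, ⟨tn, ⟨dD, dN⟩⟩⟩, rowCode uⱼ⟩⟩` -/

/-- Item getter: the yardstick. [folklore] -/
def iYd : List Bool → List Bool := nthF 0
/-- Item getter: `bin n`. [folklore] -/
def iNn : List Bool → List Bool := nthF 0 ∘ nthF 1
/-- Item getter: `rowCode t`. [folklore] -/
def iTn : List Bool → List Bool := nthF 1 ∘ nthF 1
/-- Item getter: `dpEnc D`. [folklore] -/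
def iDD : List Bool → List Bool := nthF 2 ∘ nthF 1
/-- Item getter: `bin D`. [folklore] -/
def iDN : List Bool → List Bool := sndPow 2 ∘ nthF 1
/-- Item getter: the item `rowCode uⱼ`. [folklore] -/
def iC : List Bool → List Bool := sndPow 1

/-- `e = ⟨t, uⱼ⟩` (`dotF`). [folklore] -/
def eR : List Bool → List Bool := dotF ∘ fanoutFn iYd (fanoutFn iNn (fanoutFn iTn iC))
/-- `m = round(e / D)` (`qroundF`). [folklore] -/
def mR : List Bool → List Bool := qroundF ∘ fanoutFn eR iDN
/-- **The residual item** `ε = capZ (e − m D)`. [cite: MicciancioRegev2007, Thm. 5.23 (the verifier, p. 28) — integer form] -/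
def epsItem : List Bool → List Bool := zcapF ∘ fanoutFn iYd (zsubF ∘ fanoutFn eR (zmulF ∘ fanoutFn mR iDD))

/-- The parameter record of the residual map. [folklore] -/
def prmE : List Bool → List Bool := fanoutFn gNn (fanoutFn gTn (fanoutFn gDD gDN))
/-- **The residuals** `rowCode (j ↦ εⱼ)`. [folklore] -/
def epsF : List Bool → List Bool := mapLF epsItem ∘ fanoutFn gYd (fanoutFn gNN (fanoutFn prmE gUL))
/-- `S = ∑ⱼ εⱼ²`. [folklore] -/
def SF : List Bool → List Bool := dotF ∘ fanoutFn gYd (fanoutFn gNN (fanoutFn epsF epsF))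
/-- `dpEnc (3 N)`. [folklore] -/
def threeNF : List Bool → List Bool := zmulF ∘ fanoutFn (fun _ => dpEnc 3) (natZF ∘ gNN)
/-- `dpEnc (D²)`. [folklore] -/
def d2F : List Bool → List Bool := zmulF ∘ fanoutFn gDD gDD
/-- **Test (b′)**: `[3 N D² ≤ 80 S]`. [cite: MicciancioRegev2007, Thm. 5.23 (the verifier, test (b)) — distance-to-ℤ form] -/
def testBF : List Bool → List Bool :=
  zleF ∘ fanoutFn (zmulF ∘ fanoutFn threeNF d2F) (zmulF ∘ fanoutFn (fun _ => dpEnc 80) SF)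

/-! ### The trace test -/

/-- `idxList n`. [folklore] -/
def idxnF : List Bool → List Bool := iotaF ∘ fanoutFn gYd gNn
/-- `idxList N`. [folklore] -/
def idxNF : List Bool → List Bool := iotaF ∘ fanoutFn gYd gNN
/-- `U = matCode (i j ↦ uⱼ i)` (`n × N`, the capped transpose of the witness table). [folklore] -/
def UF : List Bool → List Bool :=
  transposeF ∘ fanoutFn gYd (fanoutFn gNn (fanoutFn (fanoutFn gNN (fanoutFn gUL idxNF)) idxnF))
/-- `M = G Gᵀ` (capped Gram matrix of the rows of `U`). [folklore] -/
def MF : List Bool → List Bool := gramRF ∘ fanoutFn gYd (fanoutFn gNn (fanoutFn gNN UF))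
/-- `bin (P − 1)`. [folklore] -/
def pm1F : List Bool → List Bool := subFn ∘ fanoutFn gPP (fun _ => [true])
/-- `M' = M^{2^{P−1}}` by `P − 1` squarings. [folklore] -/
def MpF : List Bool → List Bool := sndPow 3 ∘ sqLoopF ∘ fanoutFn gYd (fanoutFn pm1F (fanoutFn gNn (fanoutFn idxnF MF)))
/-- `tr = ∑ᵢ ∑ₗ M'ᵢₗ² = tr((G Gᵀ)^{2^P})`. [folklore] -/
def trF : List Bool → List Bool := AdjMachine.traceF ∘ fanoutFn gYd (fanoutFn gNn (fanoutFn MpF MpF))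
/-- `dpEnc (100 a²)`. [folklore] -/
def alphaF : List Bool → List Bool := zmulF ∘ fanoutFn (fun _ => dpEnc 100) (zmulF ∘ fanoutFn gAa gAa)
/-- `dpEnc ((100 a²)^{2^P})` (capped). [folklore] -/
def alphaPF : List Bool → List Bool := sndPow 1 ∘ powLoopF ∘ fanoutFn gYd (fanoutFn gPP alphaF)
/-- `dpEnc (3 N D² b²)`. [folklore] -/
def betaF : List Bool → List Bool :=
  zmulF ∘ fanoutFn (zmulF ∘ fanoutFn threeNF d2F) (zmulF ∘ fanoutFn gBb gBb)
/-- `dpEnc ((3 N D² b²)^{2^P})` (capped). [folklore] -/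
def betaPF : List Bool → List Bool := sndPow 1 ∘ powLoopF ∘ fanoutFn gYd (fanoutFn gPP betaF)
/-- **Test (c′)**: `[(100 a²)^{2^P} · tr ≤ (3 N D² b²)^{2^P}]`. [cite: MicciancioRegev2007, Thm. 5.23 (the verifier, test (c)) — trace form] -/
def testCF : List Bool → List Bool := zleF ∘ fanoutFn (zmulF ∘ fanoutFn alphaPF trF) betaPF
/-- **The verdict** `[test (b′) ∧ test (c′)]`. [cite: MicciancioRegev2007, Thm. 5.23 (the verifier V, p. 28) — integer form] -/
def verdictF : List Bool → List Bool := andFn testBF testCF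

/-! ## Part B. Polynomial time -/

/-- `eR ∈ FP`. [folklore] -/
theorem eR_mem_FP : eR ∈ FP :=
  comp_mem_FP dotF_mem_FP (fanoutFn_mem_FP (nthF_mem_FP 0) (fanoutFn_mem_FP (comp_mem_FP (nthF_mem_FP 0) (nthF_mem_FP 1))
    (fanoutFn_mem_FP (comp_mem_FP (nthF_mem_FP 1) (nthF_mem_FP 1)) (sndPow_mem_FP 1))))
/-- `mR ∈ FP`. [folklore] -/
theorem mR_mem_FP : mR ∈ FP :=
  comp_mem_FP qroundF_mem_FP (fanoutFn_mem_FP eR_mem_FP (comp_mem_FP (sndPow_mem_FP 2) (nthF_mem_FP 1)))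
/-- `epsItem ∈ FP`. [folklore] -/
theorem epsItem_mem_FP : epsItem ∈ FP :=
  comp_mem_FP zcapF_mem_FP (fanoutFn_mem_FP (nthF_mem_FP 0) (comp_mem_FP zsubF_mem_FP (fanoutFn_mem_FP eR_mem_FP
    (comp_mem_FP zmulF_mem_FP (fanoutFn_mem_FP mR_mem_FP (comp_mem_FP (nthF_mem_FP 2) (nthF_mem_FP 1)))))))

/-- **`epsItem` has absolutely bounded output**: `≤ 2|yd| + 2`. [folklore] -/
theorem length_epsItem_le (yd p c : List Bool) :
    (epsItem (boolPair yd (boolPair p c))).length ≤ 0 * c.length + (2 * X + 2 : Polynomial ℕ).eval yd.length := by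
  have e : fstF (fanoutFn iYd (zsubF ∘ fanoutFn eR (zmulF ∘ fanoutFn mR iDD)) (boolPair yd (boolPair p c))) = yd := by
    rw [fanoutFn_apply, fstF_boolPair]; simp [iYd]
  calc (epsItem (boolPair yd (boolPair p c))).length
      = (zcapF (fanoutFn iYd (zsubF ∘ fanoutFn eR (zmulF ∘ fanoutFn mR iDD)) (boolPair yd (boolPair p c)))).length := rfl
    _ ≤ _ := length_zcapF_le _
    _ = 0 * c.length + (2 * X + 2 : Polynomial ℕ).eval yd.length := by rw [e]; simp [eval_add, eval_mul, eval_X]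

/-- `prmE ∈ FP`. [folklore] -/
theorem prmE_mem_FP : prmE ∈ FP :=
  fanoutFn_mem_FP (nthF_mem_FP 1) (fanoutFn_mem_FP (nthF_mem_FP 2) (fanoutFn_mem_FP (nthF_mem_FP 3) (nthF_mem_FP 4)))
/-- `epsF ∈ FP`. [folklore] -/
theorem epsF_mem_FP : epsF ∈ FP :=
  comp_mem_FP (mapLF_mem_FP epsItem_mem_FP (w := 0) (by norm_num) length_epsItem_le)
    (fanoutFn_mem_FP (nthF_mem_FP 0) (fanoutFn_mem_FP (nthF_mem_FP 7) (fanoutFn_mem_FP prmE_mem_FP (sndPow_mem_FP 8))))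
/-- `SF ∈ FP`. [folklore] -/
theorem SF_mem_FP : SF ∈ FP :=
  comp_mem_FP dotF_mem_FP (fanoutFn_mem_FP (nthF_mem_FP 0) (fanoutFn_mem_FP (nthF_mem_FP 7) (fanoutFn_mem_FP epsF_mem_FP epsF_mem_FP)))
/-- `threeNF ∈ FP`. [folklore] -/
theorem threeNF_mem_FP : threeNF ∈ FP :=
  comp_mem_FP zmulF_mem_FP (fanoutFn_mem_FP (const_mem_FP _) (comp_mem_FP natZF_mem_FP (nthF_mem_FP 7)))
/-- `d2F ∈ FP`. [folklore] -/
theorem d2F_mem_FP : d2F ∈ FP := comp_mem_FP zmulF_mem_FP (fanoutFn_mem_FP (nthF_mem_FP 3) (nthF_mem_FP 3))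
/-- `testBF ∈ FP`. [folklore] -/
theorem testBF_mem_FP : testBF ∈ FP :=
  comp_mem_FP zleF_mem_FP (fanoutFn_mem_FP (comp_mem_FP zmulF_mem_FP (fanoutFn_mem_FP threeNF_mem_FP d2F_mem_FP))
    (comp_mem_FP zmulF_mem_FP (fanoutFn_mem_FP (const_mem_FP _) SF_mem_FP)))
/-- `idxnF ∈ FP`. [folklore] -/
theorem idxnF_mem_FP : idxnF ∈ FP := comp_mem_FP iotaF_mem_FP (fanoutFn_mem_FP (nthF_mem_FP 0) (nthF_mem_FP 1))
/-- `idxNF ∈ FP`. [folklore] -/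
theorem idxNF_mem_FP : idxNF ∈ FP := comp_mem_FP iotaF_mem_FP (fanoutFn_mem_FP (nthF_mem_FP 0) (nthF_mem_FP 7))
/-- `UF ∈ FP`. [folklore] -/
theorem UF_mem_FP : UF ∈ FP :=
  comp_mem_FP transposeF_mem_FP (fanoutFn_mem_FP (nthF_mem_FP 0) (fanoutFn_mem_FP (nthF_mem_FP 1)
    (fanoutFn_mem_FP (fanoutFn_mem_FP (nthF_mem_FP 7) (fanoutFn_mem_FP (sndPow_mem_FP 8) idxNF_mem_FP)) idxnF_mem_FP)))
/-- `MF ∈ FP`. [folklore] -/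
theorem MF_mem_FP : MF ∈ FP :=
  comp_mem_FP gramRF_mem_FP (fanoutFn_mem_FP (nthF_mem_FP 0) (fanoutFn_mem_FP (nthF_mem_FP 1) (fanoutFn_mem_FP (nthF_mem_FP 7) UF_mem_FP)))
/-- `pm1F ∈ FP`. [folklore] -/
theorem pm1F_mem_FP : pm1F ∈ FP := comp_mem_FP subFn_mem_FP (fanoutFn_mem_FP (nthF_mem_FP 8) (const_mem_FP _))
/-- `MpF ∈ FP`. [folklore] -/
theorem MpF_mem_FP : MpF ∈ FP :=
  comp_mem_FP (sndPow_mem_FP 3) (comp_mem_FP sqLoopF_mem_FP (fanoutFn_mem_FP (nthF_mem_FP 0) (fanoutFn_mem_FP pm1F_mem_FP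
    (fanoutFn_mem_FP (nthF_mem_FP 1) (fanoutFn_mem_FP idxnF_mem_FP MF_mem_FP)))))
/-- `trF ∈ FP`. [folklore] -/
theorem trF_mem_FP : trF ∈ FP :=
  comp_mem_FP AdjMachine.traceF_mem_FP (fanoutFn_mem_FP (nthF_mem_FP 0) (fanoutFn_mem_FP (nthF_mem_FP 1) (fanoutFn_mem_FP MpF_mem_FP MpF_mem_FP)))
/-- `alphaF ∈ FP`. [folklore] -/
theorem alphaF_mem_FP : alphaF ∈ FP :=
  comp_mem_FP zmulF_mem_FP (fanoutFn_mem_FP (const_mem_FP _) (comp_mem_FP zmulF_mem_FP (fanoutFn_mem_FP (nthF_mem_FP 5) (nthF_mem_FP 5))))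
/-- `alphaPF ∈ FP`. [folklore] -/
theorem alphaPF_mem_FP : alphaPF ∈ FP :=
  comp_mem_FP (sndPow_mem_FP 1) (comp_mem_FP powLoopF_mem_FP (fanoutFn_mem_FP (nthF_mem_FP 0) (fanoutFn_mem_FP (nthF_mem_FP 8) alphaF_mem_FP)))
/-- `betaF ∈ FP`. [folklore] -/
theorem betaF_mem_FP : betaF ∈ FP :=
  comp_mem_FP zmulF_mem_FP (fanoutFn_mem_FP (comp_mem_FP zmulF_mem_FP (fanoutFn_mem_FP threeNF_mem_FP d2F_mem_FP))
    (comp_mem_FP zmulF_mem_FP (fanoutFn_mem_FP (nthF_mem_FP 6) (nthF_mem_FP 6))))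
/-- `betaPF ∈ FP`. [folklore] -/
theorem betaPF_mem_FP : betaPF ∈ FP :=
  comp_mem_FP (sndPow_mem_FP 1) (comp_mem_FP powLoopF_mem_FP (fanoutFn_mem_FP (nthF_mem_FP 0) (fanoutFn_mem_FP (nthF_mem_FP 8) betaF_mem_FP)))
/-- `testCF ∈ FP`. [folklore] -/
theorem testCF_mem_FP : testCF ∈ FP :=
  comp_mem_FP zleF_mem_FP (fanoutFn_mem_FP (comp_mem_FP zmulF_mem_FP (fanoutFn_mem_FP alphaPF_mem_FP trF_mem_FP)) betaPF_mem_FP)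
/-- **`verdictF ∈ FP`**: the verifier of the machine-level MR07 Thm. 5.23 runs in polynomial time.
[cite: MicciancioRegev2007, Thm. 5.23 ("V … in polynomial time", p. 28)] [cite: AroraBarak2009, §1.3] -/
theorem verdictF_mem_FP : verdictF ∈ FP := andFn_mem_FP testBF_mem_FP testCF_mem_FP

/-! ## Part C. The saturated arithmetic computed by the machine, and the stagewise values -/

namespace Spec

variable {n N : ℕ} (W : ℕ) (t : Fin n → ℤ) (D : ℕ) (u : Fin N → Fin n → ℤ)

/-- `eⱼ = ⟨t, uⱼ⟩`. [folklore] -/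
def e (j : Fin N) : ℤ := ∑ l, t l * u j l
/-- `mⱼ = round(eⱼ / D)`. [folklore] -/
def m (j : Fin N) : ℤ := round (((e t u j : ℤ) : ℚ) / ((D : ℕ) : ℚ))
/-- `εⱼ = capZ (eⱼ − mⱼ D)`. [folklore] -/
def r (j : Fin N) : ℤ := capZ W (e t u j - m t D u j * (D : ℤ))
/-- `S = ∑ⱼ εⱼ²`. [folklore] -/
def S : ℤ := ∑ j, r W t D u j * r W t D u j
/-- `U i j = capZ (uⱼ i)`. [folklore] -/
def U : Fin n → Fin N → ℤ := fun i j => capZ W (u j i)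
/-- `M = capped (U Uᵀ)`. [folklore] -/
def M : Matrix (Fin n) (Fin n) ℤ := fun i k => capZ W (∑ j, U W u i j * U W u k j)
/-- `M' = (sqStep W)^[P − 1] M`. [folklore] -/
def Mp (P : ℕ) : Matrix (Fin n) (Fin n) ℤ := (sqStep W)^[P - 1] (M W u)
/-- `tr = capZ (∑ᵢ ∑ₗ M'ᵢₗ²)`. [folklore] -/
def tr (P : ℕ) : ℤ := capZ W (∑ i, ∑ l, Mp W u P i l * Mp W u P i l)
/-- `αP = (sqZ W)^[P] (100 a²)`. [folklore] -/
def alphaP (a : ℤ) (P : ℕ) : ℤ := (sqZ W)^[P] (100 * (a * a))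
/-- `βP = (sqZ W)^[P] (3 N D² b²)`. [folklore] -/
def betaP (N : ℕ) (b : ℤ) (P : ℕ) : ℤ := (sqZ W)^[P] (3 * (N : ℤ) * ((D : ℤ) * D) * (b * b))
/-- The verdict as a Boolean: `[3 N D² ≤ 80 S] && [αP · tr ≤ βP]`. [folklore] -/
def verdict (a b : ℤ) (P : ℕ) : Bool :=
  decide (3 * (N : ℤ) * ((D : ℤ) * D) ≤ 80 * S W t D u) && decide (alphaP W a P * tr W u P ≤ betaP W D N b P)

end Spec

section Value

variable {n N : ℕ} (yd : List Bool) (t : Fin n → ℤ) (D : ℕ) (a b : ℤ) (P : ℕ) (u : Fin N → Fin n → ℤ)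

/-- The canonical input record of the verifier. [folklore] -/
abbrev inp : List Bool :=
  recOf yd (encodeNat n) (rowCode t) (dpEnc (D : ℤ)) (encodeNat D) (dpEnc a) (dpEnc b) (encodeNat N) (encodeNat P) (matCode u)

/-- The item record of the residual map for the `j`-th witness. [folklore] -/
abbrev itemRec (j : Fin N) : List Bool :=
  boolPair yd (boolPair (boolPair (encodeNat n) (boolPair (rowCode t) (boolPair (dpEnc (D : ℤ)) (encodeNat D)))) (rowCode (u j)))

variable (hn : n ≤ yd.length)

include hn

/-- `eR` on the item record: `dpEnc eⱼ`. [folklore] -/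
theorem eR_item (j : Fin N) : eR (itemRec yd t D u j) = dpEnc (Spec.e t u j) := by
  simp only [eR, Function.comp_apply, fanoutFn_apply, iYd, iNn, iTn, iC, itemRec, nthF_zero_boolPair, nthF_succ_boolPair,
    sndPow_succ_boolPair, sndPow_zero, sndF_boolPair, fstF_boolPair, nthF_zero]
  rw [dotF_apply yd hn]
  rfl

/-- `mR` on the item record (`D > 0`): `dpEnc mⱼ`. [folklore] -/
theorem mR_item (hD : 0 < D) (j : Fin N) : mR (itemRec yd t D u j) = dpEnc (Spec.m t D u j) := by
  have he := eR_item yd t D u hn j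
  rw [mR, Function.comp_apply, fanoutFn_apply, he]
  simp only [iDN, Function.comp_apply, itemRec, nthF_succ_boolPair, nthF_zero, fstF_boolPair, sndPow_succ_boolPair,
    sndPow_zero, sndF_boolPair]
  rw [qroundF_dpEnc _ hD]
  rfl

/-- **`epsItem` on the item record** (`D > 0`): `dpEnc εⱼ`. [cite: MicciancioRegev2007, Thm. 5.23 (the verifier, p. 28) — integer form] -/
theorem epsItem_item (hD : 0 < D) (j : Fin N) : epsItem (itemRec yd t D u j) = dpEnc (Spec.r yd.length t D u j) := by
  have he := eR_item yd t D u hn j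
  have hm := mR_item yd t D u hn hD j
  rw [epsItem, Function.comp_apply, fanoutFn_apply, Function.comp_apply, fanoutFn_apply, Function.comp_apply, fanoutFn_apply,
    he, hm]
  simp only [iYd, iDD, Function.comp_apply, itemRec, nthF_zero_boolPair, nthF_succ_boolPair,
    zmulF_boolPair, ival_dpEnc, zsubF_boolPair, zcapF_dpEnc_capZ]
  rfl

variable (hN : N ≤ yd.length) (hP : P ≤ yd.length) (hD : 0 < D)

include hN hD

/-- **`epsF` on the input**: `rowCode (j ↦ εⱼ)`. [folklore] -/
theorem epsF_inp : epsF (inp yd t D a b P u) = rowCode (fun j : Fin N => Spec.r yd.length t D u j) := by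
  obtain ⟨g0, g1, g2, g3, g4, -, -, g7, -, g9⟩ := getters_apply yd (encodeNat n) (rowCode t) (dpEnc (D : ℤ)) (encodeNat D)
    (dpEnc a) (dpEnc b) (encodeNat N) (encodeNat P) (matCode u)
  rw [epsF, Function.comp_apply]
  simp only [fanoutFn_apply, prmE]
  rw [inp, g0, g1, g2, g3, g4, g7, g9]
  have hmat : matCode u = encList (List.ofFn fun j => rowCode (u j)) := rfl
  rw [hmat, mapLF_apply _ _ _ hN, List.take_of_length_le (by simp), List.map_ofFn,
    rowCode_eq_ofFn (fun j : Fin N => Spec.r yd.length t D u j)]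
  refine congrArg encList (congrArg List.ofFn (funext fun j => ?_))
  exact epsItem_item yd t D u hn hD j

/-- `SF` on the input: `dpEnc S`. [folklore] -/
theorem SF_inp : SF (inp yd t D a b P u) = dpEnc (Spec.S yd.length t D u) := by
  obtain ⟨g0, -, -, -, -, -, -, g7, -, -⟩ := getters_apply yd (encodeNat n) (rowCode t) (dpEnc (D : ℤ)) (encodeNat D)
    (dpEnc a) (dpEnc b) (encodeNat N) (encodeNat P) (matCode u)
  have heps := epsF_inp yd t D a b P u hn hN hD
  rw [inp] at heps
  rw [SF, Function.comp_apply]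
  simp only [fanoutFn_apply]
  rw [inp, g0, g7, heps, dotF_apply yd hN]
  rfl

/-- **Test (b′) on the input**: `[3 N D² ≤ 80 S]`. [cite: MicciancioRegev2007, Thm. 5.23 (the verifier, test (b)) — distance-to-ℤ form] -/
theorem testBF_inp : testBF (inp yd t D a b P u) = [decide (3 * (N : ℤ) * ((D : ℤ) * D) ≤ 80 * Spec.S yd.length t D u)] := by
  obtain ⟨-, -, -, g3, -, -, -, g7, -, -⟩ := getters_apply yd (encodeNat n) (rowCode t) (dpEnc (D : ℤ)) (encodeNat D)
    (dpEnc a) (dpEnc b) (encodeNat N) (encodeNat P) (matCode u)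
  have hS := SF_inp yd t D a b P u hn hN hD
  rw [inp] at hS
  simp only [testBF, threeNF, d2F, Function.comp_apply, fanoutFn_apply, inp, g3, g7, hS, natZF_apply, bitsToNat_encodeNat,
    zmulF_boolPair, ival_dpEnc, zleF_boolPair]

omit hN hD in
/-- `idxnF` on the input: `idxList n`. [folklore] -/
theorem idxnF_inp : idxnF (inp yd t D a b P u) = idxList n := by
  obtain ⟨g0, g1, -, -, -, -, -, -, -, -⟩ := getters_apply yd (encodeNat n) (rowCode t) (dpEnc (D : ℤ)) (encodeNat D)
    (dpEnc a) (dpEnc b) (encodeNat N) (encodeNat P) (matCode u)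
  rw [idxnF, Function.comp_apply, fanoutFn_apply, inp, g0, g1, iotaF_apply _ hn]

omit hn hD in
/-- `idxNF` on the input: `idxList N`. [folklore] -/
theorem idxNF_inp : idxNF (inp yd t D a b P u) = idxList N := by
  obtain ⟨g0, -, -, -, -, -, -, g7, -, -⟩ := getters_apply yd (encodeNat n) (rowCode t) (dpEnc (D : ℤ)) (encodeNat D)
    (dpEnc a) (dpEnc b) (encodeNat N) (encodeNat P) (matCode u)
  rw [idxNF, Function.comp_apply, fanoutFn_apply, inp, g0, g7, iotaF_apply _ hN]

omit hD in
/-- `UF` on the input: `matCode U`. [folklore] -/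
theorem UF_inp : UF (inp yd t D a b P u) = matCode (Spec.U yd.length u) := by
  obtain ⟨g0, g1, -, -, -, -, -, g7, -, g9⟩ := getters_apply yd (encodeNat n) (rowCode t) (dpEnc (D : ℤ)) (encodeNat D)
    (dpEnc a) (dpEnc b) (encodeNat N) (encodeNat P) (matCode u)
  have hi := idxnF_inp yd t D a b P u hn
  have hI := idxNF_inp yd t D a b P u hN
  rw [inp] at hi hI
  rw [UF, Function.comp_apply]
  simp only [fanoutFn_apply]
  rw [inp, g0, g1, g7, g9, hi, hI, transposeF_apply _ hN hn]
  rfl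

omit hD in
/-- `MF` on the input: `matCode M`. [folklore] -/
theorem MF_inp : MF (inp yd t D a b P u) = matCode (fun i k : Fin n => Spec.M yd.length u i k) := by
  obtain ⟨g0, g1, -, -, -, -, -, g7, -, -⟩ := getters_apply yd (encodeNat n) (rowCode t) (dpEnc (D : ℤ)) (encodeNat D)
    (dpEnc a) (dpEnc b) (encodeNat N) (encodeNat P) (matCode u)
  have hU := UF_inp yd t D a b P u hn hN
  rw [inp] at hU
  rw [MF, Function.comp_apply]
  simp only [fanoutFn_apply]
  rw [inp, g0, g1, g7, hU, gramRF_apply _ hN hn]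
  rfl

omit hn hN hD in
/-- `pm1F` on the input: `bin (P − 1)`. [folklore] -/
theorem pm1F_inp : pm1F (inp yd t D a b P u) = encodeNat (P - 1) := by
  obtain ⟨-, -, -, -, -, -, -, -, g8, -⟩ := getters_apply yd (encodeNat n) (rowCode t) (dpEnc (D : ℤ)) (encodeNat D)
    (dpEnc a) (dpEnc b) (encodeNat N) (encodeNat P) (matCode u)
  have h1 : bitsToNat [true] = 1 := by simp [bitsToNat]
  rw [pm1F, Function.comp_apply, fanoutFn_apply, inp, g8, subFn_boolPair, bitsToNat_encodeNat, h1]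

include hP in
omit hD in
/-- `MpF` on the input: `matCode M'`. [folklore] -/
theorem MpF_inp : MpF (inp yd t D a b P u) = matCode (fun i k : Fin n => Spec.Mp yd.length u P i k) := by
  obtain ⟨g0, g1, -, -, -, -, -, -, -, -⟩ := getters_apply yd (encodeNat n) (rowCode t) (dpEnc (D : ℤ)) (encodeNat D)
    (dpEnc a) (dpEnc b) (encodeNat N) (encodeNat P) (matCode u)
  have hM := MF_inp yd t D a b P u hn hN
  have hi := idxnF_inp yd t D a b P u hn
  have hp := pm1F_inp yd t D a b P u
  rw [inp] at hM hi hp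
  rw [MpF, Function.comp_apply, Function.comp_apply]
  simp only [fanoutFn_apply]
  rw [inp, g0, g1, hM, hi, hp, sqLoopF_apply _ hn ((Nat.sub_le _ _).trans hP)]
  simp only [sndPow_succ_boolPair, sndPow_zero, sndF_boolPair]
  rfl

include hP in
omit hD in
/-- `trF` on the input: `dpEnc tr`. [folklore] -/
theorem trF_inp : trF (inp yd t D a b P u) = dpEnc (Spec.tr yd.length u P) := by
  obtain ⟨g0, g1, -, -, -, -, -, -, -, -⟩ := getters_apply yd (encodeNat n) (rowCode t) (dpEnc (D : ℤ)) (encodeNat D)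
    (dpEnc a) (dpEnc b) (encodeNat N) (encodeNat P) (matCode u)
  have hMp := MpF_inp yd t D a b P u hn hN hP
  rw [inp] at hMp
  rw [trF, Function.comp_apply]
  simp only [fanoutFn_apply]
  rw [inp, g0, g1, hMp, AdjMachine.traceF_apply _ hn]
  rfl

omit hn hN hD in
include hP in
/-- `alphaPF` on the input: `dpEnc αP`. [folklore] -/
theorem alphaPF_inp : alphaPF (inp yd t D a b P u) = dpEnc (Spec.alphaP yd.length a P) := by
  obtain ⟨g0, -, -, -, -, g5, -, -, g8, -⟩ := getters_apply yd (encodeNat n) (rowCode t) (dpEnc (D : ℤ)) (encodeNat D)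
    (dpEnc a) (dpEnc b) (encodeNat N) (encodeNat P) (matCode u)
  rw [alphaPF, Function.comp_apply, Function.comp_apply]
  simp only [fanoutFn_apply, alphaF, Function.comp_apply, inp, g0, g5, g8, zmulF_boolPair, ival_dpEnc]
  rw [powLoopF_apply _ hP]
  simp only [sndPow_succ_boolPair, sndPow_zero, sndF_boolPair]
  rfl

omit hn hN hD in
include hP in
/-- `betaPF` on the input: `dpEnc βP`. [folklore] -/
theorem betaPF_inp : betaPF (inp yd t D a b P u) = dpEnc (Spec.betaP yd.length D N b P) := by
  obtain ⟨g0, -, -, g3, -, -, g6, g7, g8, -⟩ := getters_apply yd (encodeNat n) (rowCode t) (dpEnc (D : ℤ)) (encodeNat D)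
    (dpEnc a) (dpEnc b) (encodeNat N) (encodeNat P) (matCode u)
  rw [betaPF, Function.comp_apply, Function.comp_apply]
  simp only [fanoutFn_apply, betaF, threeNF, d2F, Function.comp_apply, inp, g0, g3, g6, g7, g8, natZF_apply,
    bitsToNat_encodeNat, zmulF_boolPair, ival_dpEnc]
  rw [powLoopF_apply _ hP]
  simp only [sndPow_succ_boolPair, sndPow_zero, sndF_boolPair]
  rfl

include hP in
omit hD in
/-- **Test (c′) on the input**: `[αP · tr ≤ βP]`. [cite: MicciancioRegev2007, Thm. 5.23 (the verifier, test (c)) — trace form] -/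
theorem testCF_inp : testCF (inp yd t D a b P u) =
    [decide (Spec.alphaP yd.length a P * Spec.tr yd.length u P ≤ Spec.betaP yd.length D N b P)] := by
  have hA := alphaPF_inp yd t D a b P u hP
  have hT := trF_inp yd t D a b P u hn hN hP
  have hB := betaPF_inp yd t D a b P u hP
  simp only [testCF, Function.comp_apply, fanoutFn_apply, hA, hT, hB, zmulF_boolPair, ival_dpEnc, zleF_boolPair]

include hP in
/-- **The value of the verifier machine** on the canonical record (`n, N, P ≤ |yd|`, `D > 0`): the Boolean
`Spec.verdict` of the saturated arithmetic. [cite: MicciancioRegev2007, Thm. 5.23 (the verifier V, p. 28) — integer form] -/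
theorem verdictF_rec : verdictF (inp yd t D a b P u) = [Spec.verdict yd.length t D u a b P] := by
  rw [verdictF, andFn_apply (testBF_inp yd t D a b P u hn hN hD) (testCF_inp yd t D a b P u hn hN hP), Spec.verdict]

end Value

/-! ## Part D. Without saturation: the exact values -/

namespace Spec

variable {n N : ℕ} {W : ℕ} (t : Fin n → ℤ) (D : ℕ) (u : Fin N → Fin n → ℤ)

/-- The integer moment matrix `G Gᵀ = ∑ⱼ uⱼ uⱼᵀ` of the witnesses (`G i j = uⱼ i`; the `sampleMat` product of
`MRGapCVPVerifierZInt.lean`). [folklore] -/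
def gram : Matrix (Fin n) (Fin n) ℤ := (Matrix.of fun i j => u j i) * (Matrix.of fun i j => u j i)ᵀ

/-- `gram` is symmetric. [folklore] -/
theorem gram_transpose : (gram u)ᵀ = gram u := by
  rw [gram, Matrix.transpose_mul, Matrix.transpose_transpose]

/-- **The residual is short**: `|eⱼ − mⱼ D| ≤ D/2`, so `εⱼ` is not saturated once `D < 2^W`. [folklore] -/
theorem natAbs_sub_round_mul_lt (hD : 0 < D) (hDW : D < 2 ^ W) (j : Fin N) :
    (e t u j - m t D u j * (D : ℤ)).natAbs < 2 ^ W := by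
  have hD0 : (0 : ℚ) < D := by exact_mod_cast hD
  have hround := abs_sub_round (((e t u j : ℤ) : ℚ) / ((D : ℕ) : ℚ))
  have hm : (m t D u j : ℚ) = (round (((e t u j : ℤ) : ℚ) / ((D : ℕ) : ℚ)) : ℚ) := by rw [m]
  have h1 : |((e t u j - m t D u j * (D : ℤ) : ℤ) : ℚ)| ≤ (D : ℚ) / 2 := by
    push_cast
    rw [hm]
    have hrew : ((e t u j : ℤ) : ℚ) - (round (((e t u j : ℤ) : ℚ) / ((D : ℕ) : ℚ)) : ℚ) * (D : ℚ) =
        ((((e t u j : ℤ) : ℚ) / ((D : ℕ) : ℚ)) - round (((e t u j : ℤ) : ℚ) / ((D : ℕ) : ℚ))) * (D : ℚ) := by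
      field_simp
    rw [hrew, abs_mul, abs_of_pos hD0]
    calc |(((e t u j : ℤ) : ℚ) / ((D : ℕ) : ℚ)) - round (((e t u j : ℤ) : ℚ) / ((D : ℕ) : ℚ))| * (D : ℚ)
        ≤ 1 / 2 * (D : ℚ) := mul_le_mul_of_nonneg_right hround hD0.le
      _ = (D : ℚ) / 2 := by ring
  have h2 : (((e t u j - m t D u j * (D : ℤ) : ℤ).natAbs : ℕ) : ℚ) ≤ (D : ℚ) / 2 := by
    rw [Nat.cast_natAbs, Int.cast_abs]; exact h1
  have h3 : (((e t u j - m t D u j * (D : ℤ) : ℤ).natAbs : ℕ) : ℚ) < (2 : ℚ) ^ W := by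
    have : (D : ℚ) < (2 : ℚ) ^ W := by exact_mod_cast hDW
    linarith
  exact_mod_cast h3

/-- Without saturation `εⱼ = eⱼ − mⱼ D`. [folklore] -/
theorem r_eq (hD : 0 < D) (hDW : D < 2 ^ W) (j : Fin N) : r W t D u j = e t u j - m t D u j * (D : ℤ) :=
  capZ_of_lt (natAbs_sub_round_mul_lt t D u hD hDW j)

/-- Without saturation `S = ∑ⱼ (eⱼ − mⱼ D)²`. [folklore] -/
theorem S_eq (hD : 0 < D) (hDW : D < 2 ^ W) : S W t D u = ∑ j, (e t u j - m t D u j * (D : ℤ)) ^ 2 := by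
  rw [S]
  exact Finset.sum_congr rfl fun j _ => by rw [r_eq t D u hD hDW, sq]

/-- Without saturation `U i j = uⱼ i`. [folklore] -/
theorem U_eq (hu : ∀ j i, (u j i).natAbs < 2 ^ W) : U W u = fun i j => u j i := by
  funext i j; exact capZ_of_lt (hu j i)

/-- Without saturation `M = G Gᵀ`. [folklore] -/
theorem M_eq (hu : ∀ j i, (u j i).natAbs < 2 ^ W) (hM : ∀ i k, (gram u i k).natAbs < 2 ^ W) : M W u = gram u := by
  funext i k
  rw [M, U_eq u hu]
  have h : ∑ j, u j i * u j k = gram u i k := by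
    simp [gram, Matrix.mul_apply]
  rw [h]
  exact capZ_of_lt (hM i k)

/-- Without saturation `M' = (G Gᵀ)^{2^{P−1}}`. [folklore] -/
theorem Mp_eq {P : ℕ} (hu : ∀ j i, (u j i).natAbs < 2 ^ W)
    (hpow : ∀ j ≤ P - 1, ∀ i k, ((gram u ^ 2 ^ j) i k).natAbs < 2 ^ W) : Mp W u P = gram u ^ 2 ^ (P - 1) := by
  have hM : ∀ i k, (gram u i k).natAbs < 2 ^ W := fun i k => by
    have := hpow 0 (Nat.zero_le _) i k
    rwa [pow_zero, pow_one] at this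
  rw [Mp, M_eq u hu hM]
  exact iterate_sqStep_eq_pow _ (gram_transpose u) _ hpow

/-- Without saturation `tr = tr((G Gᵀ)^{2^P})` (`P ≥ 1`: `∑ᵢₗ Aᵢₗ² = tr(A Aᵀ) = tr(A²)` for the symmetric
`A = (GGᵀ)^{2^{P−1}}`). [folklore] -/
theorem tr_eq {P : ℕ} (hP : 1 ≤ P) (hu : ∀ j i, (u j i).natAbs < 2 ^ W)
    (hpow : ∀ j ≤ P - 1, ∀ i k, ((gram u ^ 2 ^ j) i k).natAbs < 2 ^ W)
    (htr : (∑ i, ∑ l, (gram u ^ 2 ^ (P - 1)) i l * (gram u ^ 2 ^ (P - 1)) i l).natAbs < 2 ^ W) :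
    tr W u P = Matrix.trace (gram u ^ 2 ^ P) := by
  rw [tr, Mp_eq u hu hpow, capZ_of_lt htr]
  set A := gram u ^ 2 ^ (P - 1) with hA
  have hsym : Aᵀ = A := by rw [hA, Matrix.transpose_pow, gram_transpose]
  have hsq : gram u ^ 2 ^ P = A * Aᵀ := by
    rw [hsym, hA, ← pow_add]
    congr 1
    obtain ⟨P', rfl⟩ := Nat.exists_eq_add_of_le' hP
    rw [Nat.add_sub_cancel, pow_succ, Nat.mul_two]
  rw [hsq, Matrix.trace]
  refine Finset.sum_congr rfl fun i _ => ?_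
  rw [Matrix.diag_apply, Matrix.mul_apply]
  rfl

/-- Without saturation `αP = (100a²)^{2^P}`. [folklore] -/
theorem alphaP_eq {a : ℤ} {P : ℕ} (hα : (100 * (a * a)).natAbs ^ 2 ^ P < 2 ^ W) :
    alphaP W a P = (100 * (a * a)) ^ 2 ^ P :=
  iterate_sqZ_eq_pow _ _ hα

/-- Without saturation `βP = (3ND²b²)^{2^P}`. [folklore] -/
theorem betaP_eq {b : ℤ} {P : ℕ} (hβ : (3 * (N : ℤ) * ((D : ℤ) * D) * (b * b)).natAbs ^ 2 ^ P < 2 ^ W) :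
    betaP W D N b P = (3 * (N : ℤ) * ((D : ℤ) * D) * (b * b)) ^ 2 ^ P :=
  iterate_sqZ_eq_pow _ _ hβ

/-- **The verdict without saturation** (`D > 0`, `P ≥ 1`, every register below `2^W`): the two integer tests
(b′) `3 N D² ≤ 80 ∑ⱼ (eⱼ − round(eⱼ/D) D)²` and (c′) `(100a²)^{2^P} tr((GGᵀ)^{2^P}) ≤ (3ND²b²)^{2^P}` — the
predicate `intAcceptsZ` of `MRGapCVPVerifierZInt.lean`, spelled out. [cite: MicciancioRegev2007, Thm. 5.23 (the verifier V, p. 28) — integer form] -/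
theorem verdict_eq {a b : ℤ} {P : ℕ} (hD : 0 < D) (hDW : D < 2 ^ W) (hP : 1 ≤ P) (hu : ∀ j i, (u j i).natAbs < 2 ^ W)
    (hpow : ∀ j ≤ P - 1, ∀ i k, ((gram u ^ 2 ^ j) i k).natAbs < 2 ^ W)
    (htr : (∑ i, ∑ l, (gram u ^ 2 ^ (P - 1)) i l * (gram u ^ 2 ^ (P - 1)) i l).natAbs < 2 ^ W)
    (hα : (100 * (a * a)).natAbs ^ 2 ^ P < 2 ^ W)
    (hβ : (3 * (N : ℤ) * ((D : ℤ) * D) * (b * b)).natAbs ^ 2 ^ P < 2 ^ W) :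
    verdict W t D u a b P =
      (decide (3 * (N : ℤ) * ((D : ℤ) * D) ≤ 80 * ∑ j, (e t u j - m t D u j * (D : ℤ)) ^ 2) &&
        decide ((100 * (a * a)) ^ 2 ^ P * Matrix.trace (gram u ^ 2 ^ P) ≤
          (3 * (N : ℤ) * ((D : ℤ) * D) * (b * b)) ^ 2 ^ P)) := by
  rw [verdict, S_eq t D u hD hDW, tr_eq u hP hu hpow htr, alphaP_eq hα, betaP_eq D hβ]

end Spec

end MRVerifierMachine

end Literature.Algebra.EuclideanLattices

end
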